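import Mathlib
import HarnessLib
import Summits.Ventures.LatticeQCDFlow.Scaling.AR1SwitchingLaw
import Summits.Ventures.LatticeQCDFlow.Scaling.AR1SwitchingProcess

/-!
# AR1SwitchingBridge — the process of `AR1SwitchingProcess` has the moments of `AR1SwitchingLaw`:
# `E W = ar1MeanWork`, `Var W = ar1WorkVar`, and for the uniform protocol
# `n_dof · Var W = ar1NegLogESS = k′ n_dof/n − (correction)`

HONEST FRAMING: exact (Metropolis-corrected) sampling algorithms for lattice gauge theory;
figures of merit are autocorrelation/cost numbers at stated couplings and volumes; no
continuum-physics claim.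

Venture `LatticeQCDFlow` (cell pub-lqcd), topic `Scaling`; FANOUT row 19 (`su2-snf`, GEN-4).
OUR WORK (definitional unfolding); nothing is cited as a fact.  The two companions were filed
independently of each other (build-lane constraint); this file joins them: the stochastic process
`ar1Work m ρ τ ξ n` on any probability space with wide-sense white-noise innovations
(`IsStdInnovations`) and `ρ² + τ² = 1` has mean `ar1MeanWork ρ d n` and variance `ar1WorkVar ρ d n`
(`d_k = m_{k+1} − m_k`), so every statement of `AR1SwitchingLaw` about those sums — the
fluctuation–dissipation identity, the closed forms, the `k′` law and its `O(n_dof/n²)` correction,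
the collapse `n·(−log ESS) → k′ n_dof` — is a statement about the process.

* `integral_ar1Work_eq_ar1MeanWork`, `variance_ar1Work_eq_ar1WorkVar` — the identifications;
* `uniformTrap_step` — `m_k = kΔ/n` has constant steps `Δ/n`;
* **`variance_ar1Work_uniform`** — for the uniformly dragged trap,
  `Var W = Δ²(1+ρ)/(n(1−ρ)) − 2Δ²ρ(1−ρ^n)/(n²(1−ρ)²)` (`ρ ≠ 1`, `n ≠ 0`);
* **`nDof_mul_variance_ar1Work_uniform`** — `n_dof · Var W = ar1NegLogESS n_dof Δ ρ n`, whence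
  `AR1SwitchingLaw.ar1NegLogESS_eq` reads `n_dof · Var W = k′ n_dof/n − n_dof·2Δ²ρ(1−ρ^n)/(n²(1−ρ)²)`
  with `k′ = Δ²(1+ρ)/(1−ρ) = Δ² · 2τ_int`.
-/

namespace Summit.Ventures.LatticeQCDFlow.Scaling

open MeasureTheory ProbabilityTheory Finset

variable {Ω : Type*} {mΩ : MeasurableSpace Ω} {P : Measure Ω} [IsProbabilityMeasure P]
  {ξ : ℕ → Ω → ℝ} (h : IsStdInnovations P ξ) (m : ℕ → ℝ) (ρ τ : ℝ) (hρτ : ρ ^ 2 + τ ^ 2 = 1)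
include h

/-- The mean work of the process IS `ar1MeanWork` (steps `d_k = m_{k+1} − m_k`). -/
theorem integral_ar1Work_eq_ar1MeanWork (n : ℕ) :
    ∫ ω, ar1Work m ρ τ ξ n ω ∂P = ar1MeanWork ρ (fun k => m (k + 1) - m k) n :=
  integral_ar1Work h m ρ τ n

include hρτ

/-- The work variance of the process IS `ar1WorkVar`. -/
theorem variance_ar1Work_eq_ar1WorkVar (n : ℕ) :
    Var[ar1Work m ρ τ ξ n; P] = ar1WorkVar ρ (fun k => m (k + 1) - m k) n :=
  variance_ar1Work h m ρ τ hρτ n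

omit h hρτ in
/-- The uniform protocol `m_k = k·Δ/n` has constant steps `Δ/n`. -/
theorem uniformTrap_step (Δ : ℝ) (n k : ℕ) :
    ((k + 1 : ℕ) : ℝ) * Δ / n - (k : ℝ) * Δ / n = Δ / n := by
  push_cast
  ring

/-- **The law, for the process.**  Dragging the trap uniformly, `m_k = kΔ/n` (`ρ ≠ 1`, `n ≠ 0`):
`Var W = Δ²(1+ρ)/(n(1−ρ)) − 2Δ²ρ(1−ρ^n)/(n²(1−ρ)²)`, i.e. `n_dof · Var W = ar1NegLogESS n_dof Δ ρ n
= k′ n_dof/n − (correction)` with `k′ = Δ²(1+ρ)/(1−ρ)` (`ar1NegLogESS_eq`). -/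
theorem variance_ar1Work_uniform (hρ : ρ ≠ 1) (Δ : ℝ) {n : ℕ} (hn : n ≠ 0) :
    Var[ar1Work (fun k => (k : ℝ) * Δ / n) ρ τ ξ n; P]
      = Δ ^ 2 * (1 + ρ) / (n * (1 - ρ)) - 2 * Δ ^ 2 * ρ * (1 - ρ ^ n) / (n ^ 2 * (1 - ρ) ^ 2) := by
  rw [variance_ar1Work_eq_ar1WorkVar h _ ρ τ hρτ n]
  have : (fun k : ℕ => ((k + 1 : ℕ) : ℝ) * Δ / n - (k : ℝ) * Δ / n) = fun _ => Δ / n := by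
    funext k; exact uniformTrap_step Δ n k
  simp only [Nat.cast_add, Nat.cast_one] at this ⊢
  rw [this]
  exact ar1WorkVar_uniform hρ Δ hn

/-- `n_dof` independent dragged coordinates: `n_dof · Var W = ar1NegLogESS n_dof Δ ρ n`, the model's
`−log ESS` of `AR1SwitchingLaw` (Gaussian dictionary). -/
theorem nDof_mul_variance_ar1Work_uniform (N Δ : ℝ) (n : ℕ) :
    N * Var[ar1Work (fun k => (k : ℝ) * Δ / n) ρ τ ξ n; P] = ar1NegLogESS N Δ ρ n := by
  rw [ar1NegLogESS, variance_ar1Work_eq_ar1WorkVar h _ ρ τ hρτ n]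
  have : (fun k : ℕ => ((k + 1 : ℕ) : ℝ) * Δ / n - (k : ℝ) * Δ / n) = fun _ => Δ / n := by
    funext k; exact uniformTrap_step Δ n k
  simp only [Nat.cast_add, Nat.cast_one] at this ⊢
  rw [this]

end Summit.Ventures.LatticeQCDFlow.Scaling
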